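import Mathlib
import HarnessLib

/-!
# Okamoto–Sakajo–Wunsch 2008: the generalised Constantin–Lax–Majda equation on the circle and its exactly
# self-similar (separable) blow-up — equation, profile equation, and the typed target of cell pub-oswblow

HONEST FRAMING (cell pub-oswblow, carried verbatim by every artefact of the cell):
**1-D model (gCLM/OSW), computer-assisted; not Euler/NS.**

Statement-level record by cell pub-oswblow (unit pub-oswblow-w2a, CAP-FLUIDS programme) of
* the equation of H. Okamoto, T. Sakajo, M. Wunsch, *On a generalization of the Constantin–Lax–Majda
  equation*, Nonlinearity **21** (2008) 2447–2461 [OkamotoSakajoWunsch2008], eq. (3):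
  `ω_t + a v ω_x − v_x ω = 0`, `v_x = Hω`, on `−π < x < π` with periodic boundary conditions, `H` the
  `2π`-periodic Hilbert transform `Hω(x) = (1/2π) p.v. ∫ ω(y) cot((x−y)/2) dy` and `v = −(−∂ₓ²)^{−1/2} ω`
  (§1); `a = 0` is the Constantin–Lax–Majda equation [ConstantinLaxMajda1985], `a = 1` De Gregorio's
  [DeGregorio1990], `a = −1` the Córdoba–Córdoba–Fontelos equation; OSW §7 conjecture blow-up for
  `−1 ≤ a < 1`. (Same equation, written `ω_t = −a u ω_x + ω u_x`, `u_x = Hω`, in P. M. Lushnikov,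
  D. A. Silantyev, M. Siegel, J. Nonlinear Sci. **31** (2021) 82 [LushnikovSilantyevSiegel2021], where it is
  also called the Okamoto–Sakajo–Wunsch model; on `S¹` near `a = 1` see J. Chen, ARMA **241** (2021)
  [Chen2021], and for `a = 1` on `ℝ` Chen–Hou–Huang, CPAM **74** (2021) [ChenHouHuang2021].)
* the EXACTLY SELF-SIMILAR (separable) blow-up ansatz for periodic data found numerically in
  [LushnikovSilantyevSiegel2021] (§1, eq. "`ω(x,t) = f(x)/(t_c − t)`", and §11): inserting `ω = f(x)/(T−t)`,
  `v = g(x)/(T−t)` into eq. (3) and multiplying by `(T−t)²` gives the PROFILE EQUATION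
  (T1) `f = −a·g·f_x + f·Hf`, `g_x = Hf`, `g = −(−∂ₓ²)^{−1/2} f` the mean-zero primitive of `Hf` (for odd `f`,
  the case of interest, `g` is odd and `g(x) = ∫₀ˣ Hf`).
  LSS report (§11) that for generic `a ∈ (a_c, 0.95]`, `a_c = 0.6890665337…`, the numerically observed `f`
  has a jump in a high-order derivative at the antipode `x = ±π`, the order growing as `a ↓ a_c`.
* the TARGET of the cell (`AnalyticSeparableProfile P lo hi`, NOT asserted anywhere in this file and not
  claimed in print as of the cell's freshness check 2026-08-19): at isolated ("quantised") parameter values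
  `a*_P` the profile `f` is REAL-ANALYTIC on the whole circle, real, odd, negative on `(0,π)`, with vanishing
  order exactly `P` (odd) at the antipode; the cell's validated numerics locate `a*₃ = 0.75527228765…`
  (`P = 3`), `a*₅ = 0.7255375558…`, `a*₇ = 0.7142134378…`. The proof is a computer-assisted
  Newton–Kantorovich (radii-polynomial) argument in a weighted `ℓ¹` space of Fourier coefficients, delivered
  OFF-Lean as a certificate with two independent implementations; Lean carries the statement, and (when the
  certificate format is fixed) its hash and checker — never an axiom.
* the COROLLARY the target implies, kernel-checked here as an implication
  (`blowup_of_analyticSeparableProfile`, `osw_blowup_from_analytic_data`): finite-time blow-up of a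
  classical, real-analytic-in-`x` solution of eq. (3) on the circle from real-analytic odd initial data at the
  explicit parameter `a = a*₃ ∈ [0.755272287, 0.755272288]`.

## Design (why no theory of the periodic Hilbert transform is needed)
A real-analytic function on `ℝ/2πℤ` is an exponentially decaying coefficient sequence `c : ℤ → ℂ`
(`ExpDecay`); `ω`, `ω_x`, `Hω` (multiplier `−i·sgn k`, so `H sin kx = −cos kx`, `H cos kx = sin kx`, the
convention of OSW §1 and LSS App. A) and OSW's velocity `v = −(−∂ₓ²)^{−1/2}ω` (the mean-zero primitive of `Hω`,
coefficients `−c_k/|k|`, `k ≠ 0`) are then absolutely convergent Fourier series written pointwise as `tsum`s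
(`fourierEval`, `derivCoeff`, `hilbertCoeff`, `velocityEval`); for odd `ω` (the only case in the target) `v` is
odd, `v(x) = ∫₀ˣ Hω`. Junk values: for a non-summable `c` every
`tsum` is `0`; all statements below quantify over `c` with `ExpDecay`, under which the series for `ω`, `ω_x`,
`Hω`, `v` converge absolutely, and the target additionally demands `f < 0` on `(0,π)` and a non-zero
antipodal Taylor coefficient, so `c = 0` is not a witness.

## What is deliberately NOT here
No candidate profile, no certified numbers, no certificate interface (the Newton–Kantorovich frame — space
`ℓ¹_ν × ℝ²`, map, constants `Y`, `Z(r)` — is the cell's FRAME.md and lands separately once both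
implementations agree); no claim about `a` other than `a*₃`'s enclosure appearing as the interval of the
`P = 3` instance; nothing about Euler or Navier–Stokes.
-/

noncomputable section

open Filter
open scoped Topology

namespace Literature.Analysis.FluidPDE.OkamotoSakajoWunsch2008

/-! ### Fourier-side vocabulary on the circle -/

/-- The character `x ↦ e^{ikx}` of `ℝ/2πℤ`, as a function of `x : ℝ`. [folklore] -/
def expChar (k : ℤ) (x : ℝ) : ℂ := Complex.exp (Complex.I * (k : ℂ) * (x : ℂ))

/-- Pointwise value `Σ_k c_k e^{ikx}` of the Fourier series with coefficient sequence `c : ℤ → ℂ`, as a `tsum`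
(absolutely convergent for summable `c`, in particular under `ExpDecay`; junk value `0` otherwise). [folklore] -/
def fourierEval (c : ℤ → ℂ) (x : ℝ) : ℂ := ∑' k : ℤ, c k * expChar k x

/-- Fourier multiplier `−i·sgn k` of the `2π`-periodic Hilbert transform
`Hω(x) = (1/2π) p.v. ∫_{−π}^{π} ω(y) cot((x−y)/2) dy` [cite: OkamotoSakajoWunsch2008, §1]: `H(e^{ikx}) = −i sgn(k) e^{ikx}`,
i.e. `H(sin kx) = −cos kx`, `H(cos kx) = sin kx` for `k ≥ 1`, `H 1 = 0`. -/
def hilbertSymbol (k : ℤ) : ℂ := -Complex.I * ((Int.sign k : ℤ) : ℂ)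

/-- Fourier coefficients of `Hω` for `ω` with coefficients `c`. [folklore] -/
def hilbertCoeff (c : ℤ → ℂ) (k : ℤ) : ℂ := hilbertSymbol k * c k

/-- Fourier coefficients of `ω_x` for `ω` with coefficients `c`. [folklore] -/
def derivCoeff (c : ℤ → ℂ) (k : ℤ) : ℂ := Complex.I * (k : ℂ) * c k

/-- OSW's velocity `v = −(−∂ₓ²)^{−1/2} ω` [cite: OkamotoSakajoWunsch2008, §1]: the MEAN-ZERO primitive of `Hω`,
`v(x) = Σ_{k ≠ 0} (−i sgn k) c_k e^{ikx}/(ik) = −Σ_{k ≠ 0} c_k e^{ikx}/|k|`, so `v_x = Hω` (the `k = 0` term is `0`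
both because `sgn 0 = 0` and because `z / 0 = 0`). For odd `ω`, `v` is odd and equals `∫₀ˣ Hω`. -/
def velocityEval (c : ℤ → ℂ) (x : ℝ) : ℂ :=
  ∑' k : ℤ, hilbertCoeff c k * expChar k x / (Complex.I * (k : ℂ))

/-- Exponential decay of Fourier coefficients, `‖c_k‖ ≤ K e^{−ρ|k|}` with `ρ > 0`: the function `Σ c_k e^{ikx}` is
real-analytic on the circle (holomorphic in the strip `|Im x| < ρ`). [folklore] -/
def ExpDecay (c : ℤ → ℂ) (ρ K : ℝ) : Prop :=
  0 < ρ ∧ ∀ k : ℤ, ‖c k‖ ≤ K * Real.exp (-ρ * |(k : ℝ)|)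

/-- The function with coefficients `c` is real-valued: `c_{−k} = conj c_k`. [folklore] -/
def IsRealSeq (c : ℤ → ℂ) : Prop := ∀ k : ℤ, c (-k) = (starRingEnd ℂ) (c k)

/-- The function with coefficients `c` is odd: `c_{−k} = −c_k`. [folklore] -/
def IsOddSeq (c : ℤ → ℂ) : Prop := ∀ k : ℤ, c (-k) = -c k

/-! ### The equation and its separable blow-up -/

/-- A CLASSICAL SOLUTION of the Okamoto–Sakajo–Wunsch equation [cite: OkamotoSakajoWunsch2008, eq. (3)]
`ω_t + a v ω_x − v_x ω = 0`, `v_x = Hω`, `v = −(−∂ₓ²)^{−1/2} ω`, on `(ℝ/2πℤ) × (−∞, T)`, given slice-wise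
by Fourier coefficients `C t : ℤ → ℂ`: every time slice is real and real-analytic (so `ω`, `ω_x`, `Hω`, `v` are
absolutely convergent series), and at every `x : ℝ` and every `t < T` the time derivative of `t ↦ ω(x,t)` exists
and equals `−a v ω_x + ω v_x` evaluated at `(x,t)`. -/
def IsClassicalSolution (a : ℝ) (C : ℝ → ℤ → ℂ) (T : ℝ) : Prop :=
  (∀ t : ℝ, t < T → (∃ ρ K : ℝ, ExpDecay (C t) ρ K) ∧ IsRealSeq (C t)) ∧
  ∀ (x t : ℝ), t < T →
    HasDerivAt (fun s : ℝ => fourierEval (C s) x)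
      (-(a : ℂ) * velocityEval (C t) x * fourierEval (derivCoeff (C t)) x
        + fourierEval (C t) x * fourierEval (hilbertCoeff (C t)) x) t

/-- COROLLARY STATEMENT of cell pub-oswblow (typed, NOT asserted): FINITE-TIME BLOW-UP OF OSW/gCLM ON THE CIRCLE
FROM REAL-ANALYTIC DATA at some parameter `a ∈ [lo, hi]` — there are `T > 0` and a classical solution of
[cite: OkamotoSakajoWunsch2008, eq. (3)] on `(ℝ/2πℤ) × (−∞, T)` (in particular from the real-analytic, real, odd
datum `ω(·,0)` on `[0,T)`) and a point `x₀` with `|ω(x₀,t)| → ∞` as `t ↑ T`. Honest framing: 1-D model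
(gCLM/OSW), computer-assisted; not Euler/NS. -/
def BlowupFromAnalyticData (lo hi : ℝ) : Prop :=
  ∃ a : ℝ, lo ≤ a ∧ a ≤ hi ∧ ∃ T : ℝ, 0 < T ∧ ∃ C : ℝ → ℤ → ℂ,
    IsClassicalSolution a C T ∧ IsOddSeq (C 0) ∧
      ∃ x₀ : ℝ, Tendsto (fun t : ℝ => ‖fourierEval (C t) x₀‖) (𝓝[<] T) atTop

/-- The PROFILE EQUATION (T1) of the exactly self-similar blow-up `ω(x,t) = f(x)/(T − t)`, `v = g/(T − t)` of the
OSW equation with periodic data [cite: LushnikovSilantyevSiegel2021, §1 and §11]: `f = −a·g·f_x + f·Hf` pointwise on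
`ℝ`, where `g = −(−∂ₓ²)^{−1/2} f` is the mean-zero primitive of `Hf` (`velocityEval`; `= ∫₀ˣ Hf` for odd `f`).
(Inserting the ansatz into OSW eq. (3) and multiplying by `(T − t)²` gives exactly this; conversely see
`blowup_of_analyticSeparableProfile`.) -/
def IsSeparableProfile (a : ℝ) (c : ℤ → ℂ) : Prop :=
  ∀ x : ℝ, fourierEval c x
    = -(a : ℂ) * velocityEval c x * fourierEval (derivCoeff c) x + fourierEval c x * fourierEval (hilbertCoeff c) x

/-- Vanishing order EXACTLY `P` at the antipode `x = π`: `f(π + y) / y^P → κ ≠ 0` as `y → 0`, `y ≠ 0` (real part;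
all uses are for real `f`). [folklore] -/
def HasAntipodalOrder (c : ℤ → ℂ) (P : ℕ) : Prop :=
  ∃ κ : ℝ, κ ≠ 0 ∧
    Tendsto (fun y : ℝ => (fourierEval c (Real.pi + y)).re / y ^ P) (𝓝[≠] 0) (𝓝 κ)

/-- **TARGET of cell pub-oswblow** ("Theorem 1A\*", typed; NOT asserted here, not claimed in print): for some
parameter `a ∈ [lo, hi]` there is a real, odd, REAL-ANALYTIC `f` on the circle (`ExpDecay` coefficients), negative on
`(0, π)`, with vanishing order exactly `P` at the antipode, solving the separable-blow-up profile equation (T1) of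
the OSW equation with that `a`. The form of the ansatz is that of [cite: LushnikovSilantyevSiegel2021, §11], who observe
NON-smooth profiles for generic `a`; analyticity at quantised `a = a*_P` is the cell's computer-assisted claim, to be
backed by an off-Lean Newton–Kantorovich certificate (two independent implementations), never by an axiom.
Honest framing: 1-D model (gCLM/OSW), computer-assisted; not Euler/NS. -/
def AnalyticSeparableProfile (P : ℕ) (lo hi : ℝ) : Prop :=
  ∃ a : ℝ, lo ≤ a ∧ a ≤ hi ∧
    ∃ (c : ℤ → ℂ) (ρ K : ℝ), ExpDecay c ρ K ∧ IsRealSeq c ∧ IsOddSeq c ∧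
      (∀ x : ℝ, 0 < x → x < Real.pi → (fourierEval c x).re < 0) ∧
      IsSeparableProfile a c ∧ HasAntipodalOrder c P

/-- The `P = 3` instance the cell certifies: `a*₃ ∈ [0.755272287, 0.755272288]` (validated numerics of the cell give
`a*₃ = 0.755272287654858155480…`; the interval is deliberately 10⁻⁹-wide). Typed target, NOT asserted.
[cite: LushnikovSilantyevSiegel2021, §11] for the ansatz; honest framing as above. -/
def AnalyticSeparableProfileA3 : Prop :=
  AnalyticSeparableProfile 3 0.755272287 0.755272288

/-! ### Sanity checks of the conventions (proved) -/

/-- Multiplier convention: `−i` on `k = 1`, `+i` on `k = −1`, `0` on `k = 0`; hence `H sin x = −cos x`,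
`H cos x = sin x`, `H 1 = 0`. [folklore] -/
theorem hilbertSymbol_one_neg_one_zero :
    hilbertSymbol 1 = -Complex.I ∧ hilbertSymbol (-1) = Complex.I ∧ hilbertSymbol 0 = 0 := by
  refine ⟨?_, ?_, ?_⟩ <;> simp [hilbertSymbol]

/-- The `k = 0` term of `v` vanishes (`v` has mean zero). [folklore] -/
theorem velocity_term_zero (c : ℤ → ℂ) (x : ℝ) :
    hilbertCoeff c 0 * expChar 0 x / (Complex.I * ((0 : ℤ) : ℂ)) = 0 := by
  simp [hilbertCoeff, hilbertSymbol]

/-! ### Scaling lemmas: the separable family `C t = c / (T − t)` slice by slice -/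

/-- `Σ (c_k / r) e^{ikx} = (Σ c_k e^{ikx}) / r`. [folklore] -/
theorem fourierEval_div_const (c : ℤ → ℂ) (r : ℂ) (x : ℝ) :
    fourierEval (fun k => c k / r) x = fourierEval c x / r := by
  unfold fourierEval
  rw [← tsum_div_const]
  refine tsum_congr fun k => ?_
  ring

/-- `(c / r)_x = c_x / r` coefficientwise, under `fourierEval`. [folklore] -/
theorem fourierEval_derivCoeff_div_const (c : ℤ → ℂ) (r : ℂ) (x : ℝ) :
    fourierEval (derivCoeff fun k => c k / r) x = fourierEval (derivCoeff c) x / r := by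
  rw [← fourierEval_div_const]
  refine congrArg (fun d => fourierEval d x) (funext fun k => ?_)
  simp only [derivCoeff]
  ring

/-- `H(c / r) = (Hc) / r` coefficientwise, under `fourierEval`. [folklore] -/
theorem fourierEval_hilbertCoeff_div_const (c : ℤ → ℂ) (r : ℂ) (x : ℝ) :
    fourierEval (hilbertCoeff fun k => c k / r) x = fourierEval (hilbertCoeff c) x / r := by
  rw [← fourierEval_div_const]
  refine congrArg (fun d => fourierEval d x) (funext fun k => ?_)
  simp only [hilbertCoeff]
  ring

/-- `v[c / r] = v[c] / r`. [folklore] -/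
theorem velocityEval_div_const (c : ℤ → ℂ) (r : ℂ) (x : ℝ) :
    velocityEval (fun k => c k / r) x = velocityEval c x / r := by
  unfold velocityEval
  rw [← tsum_div_const]
  refine tsum_congr fun k => ?_
  simp only [hilbertCoeff]
  ring

/-- Time derivative of the separable factor: `d/dt (T − t)⁻¹ = (T − t)⁻²` for `t < T`. [folklore] -/
theorem hasDerivAt_inv_sub {T t : ℝ} (ht : t < T) :
    HasDerivAt (fun s : ℝ => (T - s)⁻¹) ((T - t)⁻¹ ^ 2) t := by
  have h1 : HasDerivAt (fun s : ℝ => T - s) (-1) t := by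
    simpa using (hasDerivAt_id t).const_sub T
  have hne : T - t ≠ 0 := ne_of_gt (sub_pos.mpr ht)
  have h2 : HasDerivAt (fun s : ℝ => (T - s)⁻¹) (-(-1) / (T - t) ^ 2) t := h1.inv hne
  refine h2.congr_deriv ?_
  rw [neg_neg, one_div, inv_pow]

/-! ### The corollary, kernel-checked as an implication -/

/-- **From an analytic separable profile to blow-up from analytic data.** If `f` (coefficients `c`) is a real,
odd, real-analytic solution of (T1) with parameter `a`, negative on `(0,π)`, then
`ω(x,t) = f(x)/(1 − t)`, i.e. `C t = c/(1 − t)`, is a classical solution of the OSW equation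
[cite: OkamotoSakajoWunsch2008, eq. (3)] on `(ℝ/2πℤ) × (−∞, 1)` with real-analytic odd datum `ω(·,0) = f`, and
`|ω(π/2, t)| = |f(π/2)|/(1 − t) → ∞` as `t ↑ 1`. Pure calculus: the OSW equation at `(x,t)` is (T1) divided by
`(1 − t)²`. (The antipodal-order clause of the target is not used.) -/
theorem blowup_of_analyticSeparableProfile {P : ℕ} {lo hi : ℝ}
    (h : AnalyticSeparableProfile P lo hi) : BlowupFromAnalyticData lo hi := by
  obtain ⟨a, hlo, hhi, c, ρ, K, hdec, hreal, hodd, hneg, hT1, _hP⟩ := h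
  refine ⟨a, hlo, hhi, 1, one_pos, fun t k => c k / ((1 - t : ℝ) : ℂ), ⟨?_, ?_⟩, ?_, ?_⟩
  · -- every slice `t < 1` is real-analytic and real
    intro t ht
    have h1t : 0 < 1 - t := sub_pos.mpr ht
    refine ⟨⟨ρ, K / (1 - t), hdec.1, fun k => ?_⟩, fun k => ?_⟩
    · show ‖c k / ((1 - t : ℝ) : ℂ)‖ ≤ K / (1 - t) * Real.exp (-ρ * |(k : ℝ)|)
      rw [norm_div, Complex.norm_real, Real.norm_eq_abs, abs_of_pos h1t, div_mul_eq_mul_div]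
      exact div_le_div_of_nonneg_right (hdec.2 k) h1t.le
    · show c (-k) / ((1 - t : ℝ) : ℂ) = (starRingEnd ℂ) (c k / ((1 - t : ℝ) : ℂ))
      rw [map_div₀, Complex.conj_ofReal, hreal k]
  · -- the equation at `(x, t)`, `t < 1`
    intro x t ht
    -- the orbit through `x` is `s ↦ f(x) · (1 − s)⁻¹`
    have hfun : (fun s : ℝ => fourierEval (fun k => c k / ((1 - s : ℝ) : ℂ)) x)
        = fun s : ℝ => fourierEval c x * (((1 - s)⁻¹ : ℝ) : ℂ) := by
      funext s
      rw [fourierEval_div_const, div_eq_mul_inv, Complex.ofReal_inv]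
    have hder : HasDerivAt (fun s : ℝ => fourierEval c x * (((1 - s)⁻¹ : ℝ) : ℂ))
        (fourierEval c x * ((((1 - t)⁻¹ ^ 2 : ℝ)) : ℂ)) t :=
      ((hasDerivAt_inv_sub ht).ofReal_comp).const_mul (fourierEval c x)
    rw [hfun]
    refine hder.congr_deriv ?_
    rw [fourierEval_div_const, fourierEval_derivCoeff_div_const, fourierEval_hilbertCoeff_div_const,
      velocityEval_div_const]
    set r : ℂ := ((1 - t : ℝ) : ℂ) with hr_def
    -- OSW at `(x,t)` is (T1) times `r⁻²`
    have key : -(a : ℂ) * (velocityEval c x / r) * (fourierEval (derivCoeff c) x / r)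
          + fourierEval c x / r * (fourierEval (hilbertCoeff c) x / r)
        = fourierEval c x * r⁻¹ ^ 2 := by
      rw [show -(a : ℂ) * (velocityEval c x / r) * (fourierEval (derivCoeff c) x / r)
            + fourierEval c x / r * (fourierEval (hilbertCoeff c) x / r)
          = (-(a : ℂ) * velocityEval c x * fourierEval (derivCoeff c) x
              + fourierEval c x * fourierEval (hilbertCoeff c) x) * r⁻¹ ^ 2 by ring, ← hT1 x]
    rw [key, hr_def]
    push_cast
    ring
  · -- the datum is odd
    intro k
    show c (-k) / ((1 - 0 : ℝ) : ℂ) = -(c k / ((1 - 0 : ℝ) : ℂ))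
    rw [hodd k, neg_div]
  · -- blow-up at `x₀ = π/2`
    refine ⟨Real.pi / 2, ?_⟩
    have hneg' : (fourierEval c (Real.pi / 2)).re < 0 :=
      hneg _ (by positivity) (by linarith [Real.pi_pos])
    have hpos : 0 < ‖fourierEval c (Real.pi / 2)‖ :=
      lt_of_lt_of_le (by rw [abs_of_neg hneg']; linarith) (Complex.abs_re_le_norm _)
    have h1 : Tendsto (fun t : ℝ => 1 - t) (𝓝[<] (1 : ℝ)) (𝓝[>] (0 : ℝ)) := by
      refine tendsto_nhdsWithin_of_tendsto_nhds_of_eventually_within _ ?_ ?_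
      · have hc : Tendsto (fun t : ℝ => 1 - t) (𝓝 (1 : ℝ)) (𝓝 (1 - 1)) :=
          (continuous_const.sub continuous_id).tendsto 1
        rw [sub_self] at hc
        exact hc.mono_left nhdsWithin_le_nhds
      · exact eventually_nhdsWithin_of_forall fun t ht => Set.mem_Ioi.mpr (sub_pos.mpr (Set.mem_Iio.mp ht))
    have h2 : Tendsto (fun t : ℝ => ‖fourierEval c (Real.pi / 2)‖ * (1 - t)⁻¹) (𝓝[<] (1 : ℝ)) atTop :=
      (tendsto_inv_nhdsGT_zero.comp h1).const_mul_atTop hpos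
    refine h2.congr' ?_
    refine eventually_nhdsWithin_of_forall fun t ht => ?_
    have h1t : 0 < 1 - t := sub_pos.mpr ht
    show ‖fourierEval c (Real.pi / 2)‖ * (1 - t)⁻¹ = ‖fourierEval (fun k => c k / ((1 - t : ℝ) : ℂ)) (Real.pi / 2)‖
    rw [fourierEval_div_const, norm_div, Complex.norm_real, Real.norm_eq_abs, abs_of_pos h1t]
    ring

/-- **`osw_blowup_from_analytic_data`** — the cell's corollary in implication form (kernel-checked): the typed target
`AnalyticSeparableProfileA3` (to be delivered by the off-Lean certificate) implies FINITE-TIME BLOW-UP OF THE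
OKAMOTO–SAKAJO–WUNSCH EQUATION [cite: OkamotoSakajoWunsch2008, eq. (3)] ON THE CIRCLE FROM REAL-ANALYTIC ODD
INITIAL DATA AT THE EXPLICIT PARAMETER `a = a*₃ ∈ [0.755272287, 0.755272288]`. Honest framing: 1-D model
(gCLM/OSW), computer-assisted; not Euler/NS. -/
theorem osw_blowup_from_analytic_data (h : AnalyticSeparableProfileA3) :
    BlowupFromAnalyticData 0.755272287 0.755272288 :=
  blowup_of_analyticSeparableProfile h

end Literature.Analysis.FluidPDE.OkamotoSakajoWunsch2008

end
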